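import Literature.Computation.FiniteGraph.ReliabilityBridge
import HarnessLib

/-!
# Barrier: edge-shortening transfer of the Kozma–Nitzan inequality fails for a NON-designated relay
# (Kozma–Nitzan 2024, Theorem 13)

Barrier catalogue `Literature/Barriers/CriticalPhenomena/` (D-0021), entry for the conjunct
`PercolationContinuityZ3` (`θ(p_c) = 0` on `ℤ³` via the Kozma–Nitzan reduction, routes of the
`PercNearOneGluing…` family).  Everything here is PROVED; no facts.

Kozma–Nitzan reduce `θ(p_c) = 0` (`d ≥ 3`) to the finite-graph inequality
`P(0 ↔ b) ≥ P(0 ↔ A) · min_{a ∈ A} P(a ↔ b)` [cite: KozmaNitzan2024, Conjecture 1 (p.3); Theorem 6 (p.15)] (the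
post-FKG conjecture; its pre-FKG strengthening `P(0 ↔ b) ≥ min_a P(0 ↔ A, a ↔ b)` is Conjecture 2
[cite: KozmaNitzan2024, Conjecture 2 (p.3)]).  Their §5.3 proposes an induction on edges: with
`G^e` "the graph `G` with the probability that `e` is open set to 1" [cite: KozmaNitzan2024, §5.3 Definition
(p.34)], CONJECTURE 6 asserts that for the MINIMISER `a` of `P(a ↔ b)` and an arbitrary edge `{v,w}`,
`P_G(x ↔ b) ≥ P_G(x ↔ A) P_G(a ↔ b)` for `x ∈ {v,w}` implies
`P_{G^{vw}}(v ↔ b) ≥ P_{G^{vw}}(v ↔ A) P_{G^{vw}}(a ↔ b)` [cite: KozmaNitzan2024, Conjecture 6 (p.34)], and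
LEMMA 13 derives Conjecture 1 from it by induction on the number of edges (designate `a` in the graph with
the edge DELETED, use concavity in the edge parameter, conclude in the graph with the edge SHORTENED)
[cite: KozmaNitzan2024, Lemma 13 (p.34)].  THEOREM 13 is the printed no-go for the tempting strengthening
"for ANY `a` satisfying the hypothesis": "Conjecture 6 might tempt one to conjecture that in fact, for any
`a` for which `P_G(v ↔ b) ≥ P_G(v ↔ A)P_G(a ↔ b)` one has (40) … If true, this would reduce conjecture 1 to
a question involving a bounded number of points. Rather than giving a counterexample (one exists already in
a graph with 5 vertices and `|A| = 3`), we give an indirect argument which is more generally applicable.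
Theorem 13. There exists a graph `G`, a set `A ⊂ G`, and vertices `a ∈ A`, `b, v, w ∈ G` such that
`P_G(v ↔ b) ≥ P_G(v ↔ A)P_G(a ↔ b)` but `P_{G^{vw}}(v ↔ b) < P_{G^{vw}}(v ↔ A)P_{G^{vw}}(a ↔ b)`."
[cite: KozmaNitzan2024, §5.7 and Theorem 13 (p.37)].

This file proves Theorem 13 by an explicit certified instance (the paper's proof is indirect and its
5-vertex instance is not printed; ours has 4 vertices): `v = 0`, `A = {1, 2}`, designated relay `a = 2`,
`b = 3`, shortened pair `{v, w} = {0, 1}` (so `w ∈ A`), edge probabilities `{0,1} ↦ 1/4`, `{0,3} ↦ 1/4`,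
`{2,3} ↦ 1/2`: in `G`, `P(v ↔ b) = 1/4 ≥ P(v ↔ A) P(a ↔ b) = (11/32)(1/2)`; in `G^{vw}`,
`P(v ↔ b) = 1/4 < P(v ↔ A) P(a ↔ b) = 1 · (1/2)`.  The probabilities are evaluated by the tree's exact
engine `Literature.Computation.FiniteGraph.connProb` and its bridge to `prodBernoulli`
(`prodBernoulli_real_openConn_eq`, `prodBernoulli_real_iUnion_openConn_eq`); shortening an edge of a
weighted edge list is `setOne` (`edgeWeight_map_setOne`).

## References
* G. Kozma, S. Nitzan, *A reduction of the θ(p_c) = 0 problem to a conjectured inequality*,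
  arXiv:2401.12397 (2024), §5.3 (Conjecture 6, Lemma 13), §5.5 (Questions 7–9), §5.7 (Theorem 13) [KozmaNitzan2024].
* G. Grimmett, *Percolation*, 2nd ed., Springer 1999, §1.3 (the product measure) [Grimmett1999].
-/

noncomputable section

namespace Literature.Barriers.CriticalPhenomena

open MeasureTheory Set Literature.Probability.LatticeModels Literature.Probability.Percolation
open Literature.Computation.FiniteGraph

/-! ### Shortening one listed edge of a weighted edge list -/

/-- Set the weight of the listed pair `{v, u}` to `1` (`a/b ↦ b/b`), keeping every other entry. [folklore] -/
def setOne (v u : ℕ) (e : PercEdge) : PercEdge :=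
  if e.pairN = s(v, u) then (e.1, e.2.1, e.2.2.2, e.2.2.2) else e

/-- `setOne` keeps the pair. [folklore] -/
theorem pairN_setOne (v u : ℕ) (e : PercEdge) : (setOne v u e).pairN = e.pairN := by
  unfold setOne
  split_ifs
  · rfl
  · rfl

/-- Off the shortened pair the weights are unchanged. [folklore] -/
theorem pairWeight_map_setOne_of_ne {x y v u : ℕ} (h : s(x, y) ≠ s(v, u)) :
    ∀ E : List PercEdge, pairWeight x y (E.map (setOne v u)) = pairWeight x y E
  | [] => rfl
  | e :: E => by
      rw [List.map_cons, pairWeight, pairWeight, pairN_setOne, pairWeight_map_setOne_of_ne h E]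
      by_cases hxy : s(x, y) = e.pairN
      · have hne : e.pairN ≠ s(v, u) := fun h' => h (hxy.trans h')
        rw [if_pos hxy, if_pos hxy]
        simp only [setOne, if_neg hne]
      · rw [if_neg hxy, if_neg hxy]

/-- On the shortened pair the weight is `1` (the pair being listed, with positive denominators). [folklore] -/
theorem pairWeight_map_setOne_self {v u : ℕ} :
    ∀ E : List PercEdge, (∀ e ∈ E, 0 < e.2.2.2) → s(v, u) ∈ E.map PercEdge.pairN →
      pairWeight v u (E.map (setOne v u)) = 1
  | [], _, hmem => by simp at hmem
  | e :: E, hpos, hmem => by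
      rw [List.map_cons, pairWeight, pairN_setOne]
      by_cases hvu : s(v, u) = e.pairN
      · rw [if_pos hvu]
        have hb : (0 : ℝ) < (e.2.2.2 : ℝ) := by exact_mod_cast hpos e List.mem_cons_self
        simp only [setOne, if_pos hvu.symm]
        exact div_self hb.ne'
      · rw [if_neg hvu]
        rw [List.map_cons, List.mem_cons] at hmem
        exact pairWeight_map_setOne_self E (fun e' he' => hpos e' (List.mem_cons_of_mem _ he'))
          (hmem.resolve_left hvu)

/-- **Shortening the edge `{v, u}` = updating the weight function to `1` on `s(v, u)`.** [folklore] -/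
theorem edgeWeight_map_setOne {n : ℕ} {E : List PercEdge} (hE : edgesOK n E = true) (v u : Fin n)
    (hmem : s((v : ℕ), (u : ℕ)) ∈ E.map PercEdge.pairN) :
    edgeWeight n (E.map (setOne v u)) = Function.update (edgeWeight n E) s(v, u) 1 := by
  funext ε
  induction ε using Sym2.ind with
  | h x y =>
    by_cases h : s(x, y) = s(v, u)
    · rw [h, Function.update_self]
      apply Subtype.ext
      rw [coe_edgeWeight_mk, pairWeight_map_setOne_self E (fun e he => (edgesOK_mem hE he).2.2.2.2) hmem,
        min_self, max_eq_right zero_le_one, Set.Icc.coe_one]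
    · rw [Function.update_of_ne h]
      apply Subtype.ext
      have h' : s((x : ℕ), (y : ℕ)) ≠ s((v : ℕ), (u : ℕ)) := by
        intro hxy
        apply h
        rw [← map_val_eq_iff, Sym2.map_mk]
        exact hxy
      rw [coe_edgeWeight_mk, coe_edgeWeight_mk, pairWeight_map_setOne_of_ne h']

/-- `setOne` preserves well-formedness. [folklore] -/
theorem edgesOK_map_setOne {n : ℕ} {E : List PercEdge} (hE : edgesOK n E = true) (v u : ℕ) :
    edgesOK n (E.map (setOne v u)) = true := by
  have hnd := edgesOK_nodup hE
  simp only [edgesOK, Bool.and_eq_true, List.all_eq_true, decide_eq_true_eq, Bool.not_eq_true',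
    beq_eq_false_iff_ne, ne_eq, List.mem_map, List.map_map]
  refine ⟨?_, ?_⟩
  · rintro _ ⟨e, he, rfl⟩
    obtain ⟨h1, h2, h3, h4, h5⟩ := edgesOK_mem hE he
    unfold setOne
    split_ifs
    · exact ⟨⟨⟨⟨h1, h2⟩, h3⟩, le_rfl⟩, h5⟩
    · exact ⟨⟨⟨⟨h1, h2⟩, h3⟩, h4⟩, h5⟩
  · have : (PercEdge.pairN ∘ setOne v u) = PercEdge.pairN := funext fun e => pairN_setOne v u e
    rw [this]
    exact hnd

/-! ### The instance -/

/-- The weighted graph of the instance: vertices `0 = v`, `1 = w ∈ A`, `2 = a ∈ A`, `3 = b`; edges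
`{0,1}` (`1/4`), `{0,3}` (`1/4`), `{2,3}` (`1/2`) (the formaliser's instance; the paper's is not printed). [folklore] -/
def knThm13Edges : List PercEdge := [(0, 1, 1, 4), (0, 3, 1, 4), (2, 3, 1, 2)]

/-- The same graph with the edge `{0, 1}` shortened (`G^{vw}`). [folklore] -/
theorem knThm13Edges_setOne :
    knThm13Edges.map (setOne 0 1) = [(0, 1, 4, 4), (0, 3, 1, 4), (2, 3, 1, 2)] := by
  decide

/-- The six exact probabilities: in `G`, `P(v ↔ b) = 1/4`, `P(v ↔ A) = 11/32`, `P(a ↔ b) = 1/2`; in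
`G^{vw}`, `P(v ↔ b) = 1/4`, `P(v ↔ A) = 1`, `P(a ↔ b) = 1/2`. [folklore] -/
theorem knThm13_values :
    connProb 4 knThm13Edges 0 [3] = 1 / 4 ∧ connProb 4 knThm13Edges 0 [1, 2] = 11 / 32 ∧
      connProb 4 knThm13Edges 2 [3] = 1 / 2 ∧
      connProb 4 (knThm13Edges.map (setOne 0 1)) 0 [3] = 1 / 4 ∧
      connProb 4 (knThm13Edges.map (setOne 0 1)) 0 [1, 2] = 1 ∧
      connProb 4 (knThm13Edges.map (setOne 0 1)) 2 [3] = 1 / 2 := by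
  rw [knThm13Edges_setOne]
  decide +kernel

/-- **Kozma–Nitzan 2024, Theorem 13** (edge-shortening transfer fails for a non-designated relay): there
are a finite weighted graph `w` on `Fin n`, a relay set `A`, a relay `a ∈ A`, vertices `b, v` and a second
endpoint `u ≠ v` such that `P_w(v ↔ b) ≥ P_w(v ↔ A) · P_w(a ↔ b)` while in the SHORTENED graph
`w' = w[s(v,u) ↦ 1]` (= `G^{vu}`) `P_{w'}(v ↔ b) < P_{w'}(v ↔ A) · P_{w'}(a ↔ b)`.
[cite: KozmaNitzan2024, Theorem 13 (p.37)]

- technique_class: BOUNDED-WITNESS TRANSFER THROUGH EDGE SHORTENING — arguments that carry the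
  Kozma–Nitzan inequality `P(v ↔ b) ≥ P(v ↔ A) P(a ↔ b)` from `G` (edge deleted / at parameter `p`) to
  `G^{vw}` (edge shortened) for an ARBITRARY relay `a` satisfying it in `G`, i.e. with a witness not
  canonically designated — "this would reduce conjecture 1 to a question involving a bounded number of
  points" [cite: KozmaNitzan2024, §5.7 (p.37)].
- blocks: the "for any `a`" strengthening of Conjecture 6 and with it the bounded-number-of-points route to
  Conjecture 1 / `θ(p_c) = 0` [cite: KozmaNitzan2024, §5.7 (p.37) and Theorem 13]; inductions on edges in
  the style of Lemma 13 [cite: KozmaNitzan2024, Lemma 13 (p.34)] whose witness is NOT the designated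
  minimiser must supply their own witness-transfer step (this entry records that the generic step is false).
- because: if the transfer held for every `a`, start from a graph in which `v` is disconnected from `A`,
  where `P(v ↔ b) ≥ P(v ↔ A)P(a ↔ b)` holds for all `a` trivially, and add edges one at a time with the
  concavity argument of Lemma 13 — the inequality would follow for every graph and EVERY `a ∈ A`, which is
  false [cite: KozmaNitzan2024, Theorem 13 (proof, p.37)]; the instance certified here is a direct witness.
- evasions_known: transfer for the DESIGNATED relay — the minimiser of `P(a ↔ b)` — is Conjecture 6, open,
  "numerical evidence points towards an answer of 'yes'" [cite: KozmaNitzan2024, Conjecture 6 (p.34) and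
  §5.5 (p.36)]; alternative designations (minimiser of the post-FKG form; of `P(a ↔ b, 0 ↮ A)`; minimiser in
  the graph with the edges at `0` removed) are Questions 7–9, open [cite: KozmaNitzan2024, Questions 7–9
  (p.36)]; none proved in print.
- scope_caveats: Theorem 13 is a bare existence statement: it does not say that transfer fails for the
  designated minimiser (that is Conjecture 6), nor how often it fails, nor anything for `|A| = 1`; the
  paper's own counterexample ("5 vertices and `|A| = 3`") is not printed — the instance here (4 vertices,
  `|A| = 2`, shortened pair joining `v` to a relay) is the formaliser's choice and is not claimed to be the
  authors'; the pre-FKG (Conjecture 2) analogue is not stated in print.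
- status: established.
-/
theorem KozmaNitzan2024_thm13 :
    ∃ (n : ℕ) (w : Sym2 (Fin n) → unitInterval) (A : Finset (Fin n)) (a b v u : Fin n),
      a ∈ A ∧ v ≠ u ∧
      (prodBernoulli w).real (⋃ t ∈ A, openConn v t) * (prodBernoulli w).real (openConn a b) ≤
        (prodBernoulli w).real (openConn v b) ∧
      (prodBernoulli (Function.update w s(v, u) 1)).real (openConn v b) <
        (prodBernoulli (Function.update w s(v, u) 1)).real (⋃ t ∈ A, openConn v t) *
          (prodBernoulli (Function.update w s(v, u) 1)).real (openConn a b) := by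
  classical
  have hE : edgesOK 4 knThm13Edges = true := by decide
  have hE' : edgesOK 4 (knThm13Edges.map (setOne 0 1)) = true := edgesOK_map_setOne hE 0 1
  obtain ⟨h1, h2, h3, h4, h5, h6⟩ := knThm13_values
  refine ⟨4, edgeWeight 4 knThm13Edges, Finset.univ.filter fun t : Fin 4 => (t : ℕ) ∈ [1, 2],
    ⟨2, by norm_num⟩, ⟨3, by norm_num⟩, ⟨0, by norm_num⟩, ⟨1, by norm_num⟩, by decide, by decide, ?_, ?_⟩
  · have hU : (⋃ t ∈ Finset.univ.filter (fun t : Fin 4 => (t : ℕ) ∈ [1, 2]), openConn (⟨0, by norm_num⟩ : Fin 4) t) =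
        ⋃ (t : Fin 4) (_ : (t : ℕ) ∈ [1, 2]), openConn ⟨0, by norm_num⟩ t := by
      ext ω; simp
    rw [hU, prodBernoulli_real_iUnion_openConn_eq hE (by norm_num) [1, 2] (by decide),
      prodBernoulli_real_openConn_eq hE (by norm_num) (by norm_num),
      prodBernoulli_real_openConn_eq hE (by norm_num) (by norm_num), h1, h2, h3]
    norm_num
  · have hupd : Function.update (edgeWeight 4 knThm13Edges) s((⟨0, by norm_num⟩ : Fin 4), ⟨1, by norm_num⟩) 1 =
        edgeWeight 4 (knThm13Edges.map (setOne 0 1)) :=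
      (edgeWeight_map_setOne hE ⟨0, by norm_num⟩ ⟨1, by norm_num⟩ (by decide)).symm
    have hU : (⋃ t ∈ Finset.univ.filter (fun t : Fin 4 => (t : ℕ) ∈ [1, 2]), openConn (⟨0, by norm_num⟩ : Fin 4) t) =
        ⋃ (t : Fin 4) (_ : (t : ℕ) ∈ [1, 2]), openConn ⟨0, by norm_num⟩ t := by
      ext ω; simp
    rw [hupd, hU, prodBernoulli_real_iUnion_openConn_eq hE' (by norm_num) [1, 2] (by decide),
      prodBernoulli_real_openConn_eq hE' (by norm_num) (by norm_num),
      prodBernoulli_real_openConn_eq hE' (by norm_num) (by norm_num), h4, h5, h6]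
    norm_num

end Literature.Barriers.CriticalPhenomena
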